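import Summits.KontsevichZagierPeriods.Zeta5Search.Certificates.RecordRayCentreAsymp
import Summits.KontsevichZagierPeriods.Zeta5Search.Certificates.RayC1Forms
import HarnessLib

/-!
# ζ(5) search — certificates: asymptotic form of the centre value on the ray RayC1 (`Y ∈ [7n, 7n+1]`)
(cell `pub-zeta5`, P1 g11; port of certifier 2's `Certificates/RecordRayCentreAsymp.lean`, generic lemmas imported)

HONEST FRAMING: systematic search; no irrationality claim unless certified.

OUR work (Summit side). For `B₀ = 85n`, `B = BC1E e n` (`e ≤ 1`), any height `7n ≤ Y ≤ 7n+1` and both centre points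
(`c = 85n/2 + s`, `s ∈ [0, 1/2]`):
  `log(Nm(x₀)/D(x₀)) ≤ −256·n log n + n·Ψ + 92·log(101n) + 40`,   `Ψ = 2Γ₇(85/2) − 2Σ_j Γ₇(τ_j)`,
`τ = (15/2, 21/2, 25/2, 31/2, 35/2, 41/2, 45/2)` (`log_centre_C1_le`); `−256 = 2·85 − 4·Σ_j τ_j`. Numerically `Ψ = −508.0355`.
-/

noncomputable section

open Finset Real MeasureTheory intervalIntegral Set

namespace Summit.KontsevichZagierPeriods.Zeta5Search.RayC1

open Summit.KontsevichZagierPeriods.Zeta5Search.RecordLine (qsq Dx Nm Dx_pos Nm_pos gl Gant Gam Gant_scale gl_mono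
  gl_neg gl_nonneg Gant_zero Gant_mono Gant_sub_le Gant_mono_Y Gant_le_Gant_add log_centre_le)

/-- `g_Y(u) ≤ 2·log(101n)` for `|u| ≤ 100n`, `0 < Y ≤ 8n`, `n ≥ 1` (crude size of the stray logarithms). -/
theorem gl_le_crude_C1 {n Y u : ℝ} (hn : 1 ≤ n) (hY0 : 0 < Y) (hY : Y ≤ 8 * n) (hu : |u| ≤ 100 * n) :
    gl Y u ≤ 2 * Real.log (101 * n) := by
  unfold gl
  have h2 : 2 * Real.log (101 * n) = Real.log ((101 * n) ^ 2) := by rw [Real.log_pow]; norm_num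
  rw [h2]
  apply Real.log_le_log (by positivity)
  have hu2 : u ^ 2 ≤ (100 * n) ^ 2 := by
    rw [← sq_abs]; exact pow_le_pow_left₀ (abs_nonneg u) hu 2
  nlinarith

/-- The reduced window half-widths `τ_j = (85 − 2β_j)/2`. -/
def tauC1 (j : ℕ) : ℝ := (85 - 2 * (βC1 j : ℝ)) / 2

/-- The linear-in-`n` coefficient `Ψ = 2Γ₇(85/2) − 2Σ_j Γ₇(τ_j)` (numerically `−508.0355`). -/
def PsiC1 : ℝ := 2 * Gam 7 (85 / 2) - 2 * ∑ j ∈ range 7, Gam 7 (tauC1 j)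

/-- `Σ_j τ_j = 213/2`. -/
theorem sum_tauC1 : ∑ j ∈ range 7, tauC1 j = 213 / 2 := by
  simp [sum_range_succ, tauC1, βC1]
  norm_num

set_option maxHeartbeats 1600000 in
/-- **ASYMPTOTIC FORM OF THE CENTRE VALUE (ray RayC1 and partner, heights `7n ≤ Y ≤ 7n+1`).** For `e ≤ 1`, `n ≥ 1`,
`0 ≤ s ≤ 1/2` and `c = 85n/2 + s` (centre points `x₀ = −1 − c`):
`log(Nm(x₀)/D(x₀)) ≤ −256·n·log n + n·Ψ + 92·log(101n) + 40`. -/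
theorem log_centre_C1_le {e n : ℕ} (he : e ≤ 1) (hn : 1 ≤ n) {Y : ℝ} (hY1 : 7 * (n : ℝ) ≤ Y)
    (hY2 : Y ≤ 7 * n + 1) {s : ℝ} (hs0 : 0 ≤ s) (hs1 : s ≤ 1 / 2) :
    Real.log (Nm (85 * n) Y (-1 - (85 * (n : ℝ) / 2 + s)) / Dx (85 * n) (BC1E e n) Y (-1 - (85 * (n : ℝ) / 2 + s)))
      ≤ -256 * n * Real.log n + n * PsiC1 + 92 * Real.log (101 * n) + 40 := by
  have hnR : (1 : ℝ) ≤ n := by exact_mod_cast hn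
  have hn0 : (0 : ℝ) < n := by linarith
  have hYpos : 0 < Y := by linarith
  have hYge1 : 1 ≤ Y := by linarith
  have hY8 : Y ≤ 8 * n := by linarith
  have h7n : (0 : ℝ) < 7 * n := by linarith
  set c : ℝ := 85 * (n : ℝ) / 2 + s with hc
  -- the structural bound
  have hB : ∀ j ∈ range 7, 2 * BC1E e n j + 5 ≤ 85 * n := by
    intro j hj
    have hb := βC1_le j
    unfold BC1E
    split_ifs with h6
    · subst h6
      have h20 : βC1 6 = 20 := by simp [βC1]
      rw [h20]; omega
    · have : βC1 j * n ≤ 35 * n := Nat.mul_le_mul_right _ hb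
      omega
  have hmain := log_centre_le (85 * n) (BC1E e n) hB hYge1 (c := c)
    (by rw [hc]; push_cast; linarith) (by rw [hc]; push_cast; linarith)
  -- the stray logarithms
  have hlog101 : 0 ≤ Real.log (101 * n) := Real.log_nonneg (by linarith)
  have g_half : gl Y (1 / 2) ≤ 2 * Real.log (101 * n) :=
    gl_le_crude_C1 hnR hYpos hY8 (by rw [abs_of_nonneg (by norm_num)]; linarith)
  have g_c : gl Y c ≤ 2 * Real.log (101 * n) :=
    gl_le_crude_C1 hnR hYpos hY8 (by rw [hc, abs_of_nonneg (by positivity)]; linarith)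
  have g_1 : gl Y 1 ≤ 2 * Real.log (101 * n) :=
    gl_le_crude_C1 hnR hYpos hY8 (by rw [abs_of_nonneg (by norm_num)]; linarith)
  have G_1 : Gant Y 1 ≤ 2 * Real.log (101 * n) := by
    have h := Gant_sub_le (Y := Y) (a := 0) (b := 1) (M := 1) hYpos.ne' (by norm_num)
      (fun x hx => by rw [abs_le]; constructor <;> linarith [hx.1, hx.2])
    rw [Gant_zero] at h
    linarith
  have G_1_nonneg : 0 ≤ Gant Y 1 := by rw [← Gant_zero Y]; exact Gant_mono hYge1 (by norm_num)
  have hlog4 : Real.log 4 ≤ 2 := by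
    have := Real.log_le_sub_one_of_pos (show (0:ℝ) < 4 by norm_num)
    have h2 : Real.log 4 = 2 * Real.log 2 := by
      rw [show (4:ℝ) = 2 ^ 2 by norm_num, Real.log_pow]; norm_num
    have := Real.log_two_lt_d9
    linarith
  -- scaling at height 7n
  have hscale : ∀ τ : ℝ, Gant (7 * n) (τ * n) = 2 * τ * n * Real.log n + n * Gam 7 τ := fun τ => by
    have := Gant_scale hn0 (by norm_num : (0:ℝ) < 7) τ
    rw [show (7 : ℝ) * n = 7 * n by ring] at this
    exact this
  -- the two big positive terms
  have hbigY : ∀ t : ℝ, 0 ≤ t → t ≤ 85 * n / 2 + 1 →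
      Gant Y t ≤ n * Gam 7 (85 / 2) + 85 * n * Real.log n + 2 * Real.log (101 * n) + 17 := by
    intro t ht0 ht1
    have h1 := Gant_le_Gant_add h7n hY1 ht0
    have hcorr : t * ((Y ^ 2 - (7 * n) ^ 2) / (7 * n) ^ 2) ≤ 17 := by
      have hnum : Y ^ 2 - (7 * (n : ℝ)) ^ 2 ≤ 14 * n + 1 := by nlinarith
      have hden : (0 : ℝ) < (7 * n) ^ 2 := by positivity
      calc t * ((Y ^ 2 - (7 * n) ^ 2) / (7 * n) ^ 2) ≤ (85 * n / 2 + 1) * ((14 * n + 1) / (7 * n) ^ 2) := by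
            apply mul_le_mul ht1 _ (by apply div_nonneg; nlinarith; positivity) (by positivity)
            exact div_le_div_of_nonneg_right hnum hden.le
        _ ≤ 17 := by
            rw [← sub_nonneg]
            have : (85 * (n : ℝ) / 2 + 1) * ((14 * n + 1) / (7 * n) ^ 2) = (85 * n / 2 + 1) * (14 * n + 1) / (49 * n ^ 2) := by
              ring
            rw [this, sub_nonneg, div_le_iff₀ (by positivity)]
            nlinarith
    have h2 : Gant (7 * n) t ≤ Gant (7 * n) (85 / 2 * n) + 1 * gl (7 * n) (85 * n / 2 + 1) := by
      rcases le_or_gt t (85 / 2 * n) with hle | hgt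
      · have := Gant_mono (Y := 7 * n) (by linarith) hle
        have hg : 0 ≤ gl (7 * n) (85 * n / 2 + 1) := gl_nonneg (by linarith) _
        linarith
      · have := Gant_sub_le (Y := 7 * n) (a := 85 / 2 * n) (b := t) (M := 85 * n / 2 + 1) h7n.ne' hgt.le
          (fun x hx => by rw [abs_of_nonneg (by linarith [hx.1])]; linarith [hx.2])
        have hg : 0 ≤ gl (7 * n) (85 * n / 2 + 1) := gl_nonneg (by linarith) _
        nlinarith
    have h3 : gl (7 * n) (85 * n / 2 + 1) ≤ 2 * Real.log (101 * n) :=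
      gl_le_crude_C1 hnR h7n (by linarith) (by rw [abs_of_nonneg (by positivity)]; linarith)
    have h4 := hscale (85 / 2)
    rw [show (85 / 2 : ℝ) * n = 85 / 2 * n by ring] at h4
    nlinarith
  -- the window terms
  have hwin : ∀ j ∈ range 7, ∀ t : ℝ, tauC1 j * n - 3 / 2 ≤ t →
      n * Gam 7 (tauC1 j) + 2 * tauC1 j * n * Real.log n - 4 * Real.log (101 * n) ≤ Gant Y t := by
    intro j hj t ht
    have hj7 := mem_range.1 hj
    have hβhi : (βC1 j : ℝ) ≤ 35 := by exact_mod_cast βC1_le j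
    have hβlo : (20 : ℝ) ≤ βC1 j := by exact_mod_cast βC1_ge hj7
    have hτ : (15 : ℝ) / 2 ≤ tauC1 j ∧ tauC1 j ≤ 45 / 2 := by
      unfold tauC1; constructor <;> linarith
    have ht0 : 0 ≤ t := by nlinarith
    have h1 : Gant (7 * n) t ≤ Gant Y t := Gant_mono_Y h7n hY1 ht0
    have h2 : Gant (7 * n) (tauC1 j * n) - 3 / 2 * gl (7 * n) (tauC1 j * n) ≤ Gant (7 * n) t := by
      rcases le_or_gt (tauC1 j * n) t with hle | hgt
      · have := Gant_mono (Y := 7 * n) (by linarith) hle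
        have hg : 0 ≤ gl (7 * n) (tauC1 j * n) := gl_nonneg (by linarith) _
        linarith
      · have := Gant_sub_le (Y := 7 * n) (a := t) (b := tauC1 j * n) (M := tauC1 j * n) h7n.ne' hgt.le
          (fun x hx => by rw [abs_of_nonneg (by linarith [hx.1])]; exact hx.2)
        have hg : 0 ≤ gl (7 * n) (tauC1 j * n) := gl_nonneg (by linarith) _
        nlinarith
    have h3 : gl (7 * n) (tauC1 j * n) ≤ 2 * Real.log (101 * n) :=
      gl_le_crude_C1 hnR h7n (by linarith) (by rw [abs_of_nonneg (by nlinarith)]; nlinarith)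
    have h4 := hscale (tauC1 j)
    nlinarith
  -- the window arguments are large enough
  have hargs : ∀ j ∈ range 7, tauC1 j * n - 3 / 2 ≤ c - (BC1E e n j : ℝ) ∧
      tauC1 j * n - 3 / 2 ≤ (85 * n : ℕ) - (BC1E e n j : ℝ) - c := by
    intro j hj
    have hj7 := mem_range.1 hj
    have hBjN : BC1E e n j ≤ βC1 j * n + 1 := by
      unfold BC1E; split_ifs <;> omega
    have hBj : (BC1E e n j : ℝ) ≤ (βC1 j : ℝ) * n + 1 := by exact_mod_cast hBjN
    have hτj : tauC1 j * n = (85 - 2 * (βC1 j : ℝ)) / 2 * n := by unfold tauC1; ring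
    rw [hτj, hc]
    push_cast
    constructor <;> nlinarith
  -- assemble
  have hsum : ∑ j ∈ range 7, (Gant Y (c - BC1E e n j) + Gant Y ((85 * n : ℕ) - BC1E e n j - c) - 2 * Gant Y 1) ≥
      ∑ j ∈ range 7, (2 * (n * Gam 7 (tauC1 j) + 2 * tauC1 j * n * Real.log n) - 12 * Real.log (101 * n)) := by
    apply sum_le_sum
    intro j hj
    obtain ⟨ha1, ha2⟩ := hargs j hj
    have w1 := hwin j hj _ ha1
    have w2 := hwin j hj _ ha2
    linarith
  have hτsum : ∑ j ∈ range 7, (2 * (n * Gam 7 (tauC1 j) + 2 * tauC1 j * n * Real.log n) - 12 * Real.log (101 * n))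
      = 2 * n * (∑ j ∈ range 7, Gam 7 (tauC1 j)) + 426 * n * Real.log n - 84 * Real.log (101 * n) := by
    have e1 : ∀ j ∈ range 7, (2 * (n * Gam 7 (tauC1 j) + 2 * tauC1 j * n * Real.log n) - 12 * Real.log (101 * n))
        = (2 * n) * Gam 7 (tauC1 j) + (4 * n * Real.log n) * tauC1 j - 12 * Real.log (101 * n) := fun j _ => by ring
    rw [sum_congr rfl e1, sum_sub_distrib, sum_add_distrib, ← mul_sum, ← mul_sum, sum_const, card_range, sum_tauC1,
      nsmul_eq_mul]
    push_cast
    ring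
  have hc0 : 0 ≤ c := by rw [hc]; positivity
  have hc1 : c ≤ 85 * n / 2 + 1 := by rw [hc]; linarith
  have hpos1 := hbigY c hc0 hc1
  have hpos2 := hbigY ((85 * n : ℕ) + 1 - c) (by rw [hc]; push_cast; linarith) (by rw [hc]; push_cast; linarith)
  have hΨ : n * PsiC1 = 2 * (n * Gam 7 (85 / 2)) - 2 * n * ∑ j ∈ range 7, Gam 7 (tauC1 j) := by
    unfold PsiC1; ring
  have hlogn : 0 ≤ Real.log n := Real.log_nonneg hnR
  rw [hΨ]
  push_cast at hmain hpos2 hsum ⊢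
  linarith [hsum, hτsum.le, hτsum.ge]

end Summit.KontsevichZagierPeriods.Zeta5Search.RayC1
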